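import Literature.NumberTheory.Automorphic.RelNormOneCharacterFromFiniteCentre
import Summits.HodgeConjecture.HodgeCM.Model.AdelicThetaDistribution
import Summits.HodgeConjecture.HodgeCM.Model.ArchKTypeOfTorus
import HarnessLib

/-!
# FLOOR-0 P4, seat S4b(ii) — THE (χ) JUNCTION: `D.chiFin χ̃ = e · χ₁` for an automorphic `χ̃` of `[U(1)]` built from finite characters

Cell hodgecm-mathlib (D-0151), FLOOR 0, crux item H413 = stmt-HodgeConjecture-24833; programme P4, line
`Cruxes/H413/Lines/F0_P4AdmissibleOccursInH1.lean` ED. 2, stub S4b `stub_T3a_holThetaAtAdmissibleLineOfRallisAt`; PLAN-F0P4 v2 §3 row (χ)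
∕ §5.3 (F0P4-p02), F0P4-p01 (g0) ask 2026-08-30T22:26:19Z.  Namespace `Summit.HodgeConjecture.HodgeConjecture.Cruxes.H413.ThetaNonvanishing`.
`--supports stmt-HodgeConjecture-24833 --as helper`.  DEF-FREE (theorems only).

The capstone ★ `Theorems/H413HolRealOfTransport.exists_holReal_of_transport` (seat (i)) consumes, for the model's theta-distribution datum `D`
over the side at the admissible line `a` and a character `χ̃ : PontryaginDual (relNormOneIdeles L⁺ L ⧸ relNormOneRat L⁺ L)` of `[U(1)]`, the row
**`hχ : ∀ u, D.chiFin χ̃ u = e u * χ₁ u`** (`e = finCharZero(1,·)` of ★ `finRepZero_inr_finSBReindex`, `χ₁` the character of the line transport).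
★ `Literature/NumberTheory/Automorphic/RelNormOneCharacterFromFiniteCentre` (brick 9) builds, from ANY continuous unitary character `ψ` of
`U(J)(𝔸_{L⁺,f})` trivial on the finite parts of `U(J)(L⁺)`, the automorphic character `cmCentreFinCharQuot ψ` of `[U(1)]`, TRIVIAL AT `∞`, with
`χ̃([♯det(1_∞, b)]) = ψ(b)` on a line.  This file reads it in the MODEL's spelling:

* `coe_cmCentreFinCharQuot_mk_finLineTorusIdeles` — `χ̃([finLineTorusIdeles a u]) = ψ u` (the model's `toIdele` of the line `⟨a⟩`,
  `HodgeCM/Model/ArchKTypeOfTorus`; ★ `distDatumAt_toIdele`), and its `ℂˣ`-inverse form;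
* `chiFin_cmCentreFinCharQuot` — **`D.chiFin χ̃ u = (ψ (φ u))⁻¹`** for ANY datum `D` whose `toIdele` is `finLineTorusIdeles a ∘ φ`
  (`φ := id`, `hto := fun _ => rfl` for ★ `ThetaDistAtLine.distDatumAt`); `chiFin_cmCentreFinCharQuot_eq_mul` — the `hχ` shape for `ψ = (e·χ₁)⁻¹`;
* **`exists_chiFin_eq_mul`** — for two continuous unitary characters `e χ₁ : U(⟨a⟩)(𝔸_{L⁺,f}) →* ℂˣ` trivial on `finPart (CMRat L (lineVec a))`:
  `∃ χ̃, (∀ y, χ̃([(y,1)]) = 1) ∧ ∀ u, D.chiFin χ̃ u = e (φ u) * χ₁ (φ u)` — the (χ) row, assembled; what remains for its user is the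
  continuity ∕ unitarity ∕ rationality of `finCharZero(1,·)` and of the transport character (seat (i), LT).

HC_CM is proved only modulo the printed citations until rung 0 closes; this file proves nothing about them.

## References
* [Liu2021] Y. Liu, Camb. J. Math. 9 (2021) = arXiv:2102.11518, Def. 4.11 (l. 2090), proof of Prop. 4.13 (l. 2145), App. D §D.1 Step 3 (l. 5219–5221).
* Tree: ★ `Literature/NumberTheory/Automorphic/RelNormOneCharacterFromFiniteCentre` (`cmCentreFinCharQuot`, `…_mk_cmAdelicDet_finAdelicToAdelic`),
  `HodgeCM/Model/ArchKTypeOfTorus` (`finLineTorusIdeles`), `HodgeCM/Model/AdelicThetaDistribution` (`ThetaDistDatum.chiFin`),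
  ★ `Theorems/H413ThetaDistAtLine` (`distDatumAt_toIdele`), ★ `Theorems/H413HolRealOfTransport` (`exists_holReal_of_transport`, row `hχ`).
-/

set_option autoImplicit false
set_option linter.dupNamespace false

noncomputable section

open NumberField hiding relNormOneIdeles relNormOneRat
open Topology

/-! ## The (χ) junction in the model's spelling: `finLineTorusIdeles`, `ThetaDistDatum.chiFin` -/

namespace Summit.HodgeConjecture.HodgeConjecture.Cruxes.H413.ThetaNonvanishing

open Literature.NumberTheory.Automorphic Literature.NumberTheory.Automorphic.UnitaryGroup
open Literature.NumberTheory.GelbartRogawski1991.UnitaryDualPair (lineVec CMRat)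
open HodgeCM.Model.ArchSideTerm (finLineTorusIdeles)

section Line

variable (K : Type) [Field K] [NumberField K] [IsCMField K] (a : K) (ha0 : a ≠ 0)
  (ψ : ↥(UnitaryGroup.finAdelic (↥(maximalRealSubfield K)) K (IsCMField.complexConj K) 1 (Matrix.diagonal (lineVec K a))) →* ℂˣ)
  (hψc : Continuous fun b => ((ψ b : ℂˣ) : ℂ)) (hψ1 : ∀ b, ‖((ψ b : ℂˣ) : ℂ)‖ = 1)
  (hψ : ∀ g ∈ CMRat K (lineVec K a),
    ψ (UnitaryGroup.finPart (↥(maximalRealSubfield K)) K (IsCMField.complexConj K) 1 (Matrix.diagonal (lineVec K a)) g) = 1)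

/-- **`χ̃([finLineTorusIdeles u]) = ψ(u)`**: the model's torus identification `finLineTorusIdeles a = ♯det ∘ (1_∞, ·)` of the line `⟨a⟩`
(`HodgeCM/Model/ArchKTypeOfTorus`) is, definitionally, the argument of ★ `coe_cmCentreFinCharQuot_mk_cmAdelicDet_finAdelicToAdelic` with
`d := lineVec a`. [cite: Liu2021, Def. 4.11 (l. 2090); proof of Prop. 4.13 (l. 2145)] -/
theorem coe_cmCentreFinCharQuot_mk_finLineTorusIdeles
    (u : ↥(UnitaryGroup.finAdelic (↥(maximalRealSubfield K)) K (IsCMField.complexConj K) 1 (Matrix.diagonal (lineVec K a)))) :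
    ((cmCentreFinCharQuot K 1 (Matrix.diagonal (lineVec K a)) ψ hψc hψ1 hψ (QuotientGroup.mk (finLineTorusIdeles K a ha0 u)) : Circle) : ℂ) =
      ((ψ u : ℂˣ) : ℂ) :=
  coe_cmCentreFinCharQuot_mk_cmAdelicDet_finAdelicToAdelic K (lineVec K a) (fun _ => ha0) ψ hψc hψ1 hψ u

/-- the `ℂˣ`-inverse form (the currency of `ThetaDistDatum.chiFin`). [cite: Liu2021, proof of Prop. 4.13 (l. 2145)] -/
theorem toUnits_cmCentreFinCharQuot_mk_finLineTorusIdeles_inv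
    (u : ↥(UnitaryGroup.finAdelic (↥(maximalRealSubfield K)) K (IsCMField.complexConj K) 1 (Matrix.diagonal (lineVec K a)))) :
    Circle.toUnits ((cmCentreFinCharQuot K 1 (Matrix.diagonal (lineVec K a)) ψ hψc hψ1 hψ (QuotientGroup.mk (finLineTorusIdeles K a ha0 u)))⁻¹) =
      (ψ u)⁻¹ :=
  toUnits_cmCentreFinCharQuot_mk_cmAdelicDet_finAdelicToAdelic_inv K (lineVec K a) (fun _ => ha0) ψ hψc hψ1 hψ u

end Line

/-! ## `D.chiFin χ̃` for a theta-distribution datum whose torus is read through `finLineTorusIdeles a` -/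

section Datum

open HodgeCM HodgeCM.Model HodgeCM.Model.ThetaAdelicSide

variable {L : HodgeCM.CMField} {ι₁ : L →+* ℂ} {V : HodgeCM.HermSpace3 L ι₁} {c : SeesawCtx L} {S : ThetaAdelicSide V c}
  {hV : IsAnisotropic L (HodgeCM.HermSpace3.Hm V)} {k : Fin 4} (D : S.ThetaDistDatum hV k)
  (a : (L : Type)) (ha0 : a ≠ 0)
  (φ : D.Uf → ↥(UnitaryGroup.finAdelic (↥(maximalRealSubfield L)) (L : Type) (IsCMField.complexConj L) 1 (Matrix.diagonal (lineVec (L : Type) a))))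
  (hto : ∀ u, D.toIdele u = finLineTorusIdeles (L : Type) a ha0 (φ u))
  (ψ : ↥(UnitaryGroup.finAdelic (↥(maximalRealSubfield L)) (L : Type) (IsCMField.complexConj L) 1 (Matrix.diagonal (lineVec (L : Type) a))) →* ℂˣ)
  (hψc : Continuous fun b => ((ψ b : ℂˣ) : ℂ)) (hψ1 : ∀ b, ‖((ψ b : ℂˣ) : ℂ)‖ = 1)
  (hψ : ∀ g ∈ CMRat (L : Type) (lineVec (L : Type) a),
    ψ (UnitaryGroup.finPart (↥(maximalRealSubfield L)) (L : Type) (IsCMField.complexConj L) 1 (Matrix.diagonal (lineVec (L : Type) a)) g) = 1)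

/-- `D.chiFin χ = toUnits (χ(toIdele u))⁻¹` (definitional reading of the model's `chiFin`). -/
theorem chiFin_apply_eq_toUnits
    (χ : PontryaginDual (↥(Literature.NumberTheory.Automorphic.relNormOneIdeles (↥(maximalRealSubfield L)) (L : Type)) ⧸
      Literature.NumberTheory.Automorphic.relNormOneRat (↥(maximalRealSubfield L)) (L : Type)))
    (u : D.Uf) : D.chiFin χ u = Circle.toUnits ((χ (QuotientGroup.mk (D.toIdele u)))⁻¹) := rfl

include hto in
/-- **`D.chiFin χ̃ u = (ψ (φ u))⁻¹`** for the descended character `χ̃ = cmCentreFinCharQuot ψ` and ANY datum `D` whose torus identification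
is `finLineTorusIdeles a` along `φ` (for the datum at the line, ★ `distDatumAt_toIdele`: `φ := id`, `hto := fun _ => rfl`).
[cite: Liu2021, proof of Prop. 4.13 (l. 2145); App. D §D.1 Step 3 (l. 5219–5221)] -/
theorem chiFin_cmCentreFinCharQuot (u : D.Uf) :
    D.chiFin (cmCentreFinCharQuot (L : Type) 1 (Matrix.diagonal (lineVec (L : Type) a)) ψ hψc hψ1 hψ) u = (ψ (φ u))⁻¹ := by
  rw [chiFin_apply_eq_toUnits, hto, toUnits_cmCentreFinCharQuot_mk_finLineTorusIdeles_inv]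

include hto in
/-- **THE `hχ` ROW OF THE CAPSTONE** (★ `ThetaJunction.exists_holReal_of_transport`): if `ψ = (e · χ₁)⁻¹` along `φ` then
`D.chiFin χ̃ u = e u * χ₁ u`. [cite: Liu2021, proof of Prop. 4.13 (l. 2145); App. D §D.1 Step 3 (l. 5219–5221)] -/
theorem chiFin_cmCentreFinCharQuot_eq_mul (e χ₁ : D.Uf → ℂˣ) (hψe : ∀ u, ψ (φ u) = (e u * χ₁ u)⁻¹) (u : D.Uf) :
    D.chiFin (cmCentreFinCharQuot (L : Type) 1 (Matrix.diagonal (lineVec (L : Type) a)) ψ hψc hψ1 hψ) u = e u * χ₁ u := by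
  rw [chiFin_cmCentreFinCharQuot D a ha0 φ hto, hψe, inv_inv]

end Datum

/-! ## The assembled existence statement: `χ̃` from two continuous unitary rational-trivial characters `e`, `χ₁` of `U(⟨a⟩)(𝔸_f)` -/

section Assembled

open HodgeCM HodgeCM.Model HodgeCM.Model.ThetaAdelicSide

variable {L : HodgeCM.CMField} {ι₁ : L →+* ℂ} {V : HodgeCM.HermSpace3 L ι₁} {c : SeesawCtx L} {S : ThetaAdelicSide V c}
  {hV : IsAnisotropic L (HodgeCM.HermSpace3.Hm V)} {k : Fin 4} (D : S.ThetaDistDatum hV k)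
  (a : (L : Type)) (ha0 : a ≠ 0)
  (φ : D.Uf → ↥(UnitaryGroup.finAdelic (↥(maximalRealSubfield L)) (L : Type) (IsCMField.complexConj L) 1 (Matrix.diagonal (lineVec (L : Type) a))))
  (hto : ∀ u, D.toIdele u = finLineTorusIdeles (L : Type) a ha0 (φ u))
  (e χ₁ : ↥(UnitaryGroup.finAdelic (↥(maximalRealSubfield L)) (L : Type) (IsCMField.complexConj L) 1 (Matrix.diagonal (lineVec (L : Type) a))) →* ℂˣ)
  (hec : Continuous fun b => ((e b : ℂˣ) : ℂ)) (he1 : ∀ b, ‖((e b : ℂˣ) : ℂ)‖ = 1)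
  (herat : ∀ g ∈ CMRat (L : Type) (lineVec (L : Type) a),
    e (UnitaryGroup.finPart (↥(maximalRealSubfield L)) (L : Type) (IsCMField.complexConj L) 1 (Matrix.diagonal (lineVec (L : Type) a)) g) = 1)
  (hχc : Continuous fun b => ((χ₁ b : ℂˣ) : ℂ)) (hχ1 : ∀ b, ‖((χ₁ b : ℂˣ) : ℂ)‖ = 1)
  (hχrat : ∀ g ∈ CMRat (L : Type) (lineVec (L : Type) a),
    χ₁ (UnitaryGroup.finPart (↥(maximalRealSubfield L)) (L : Type) (IsCMField.complexConj L) 1 (Matrix.diagonal (lineVec (L : Type) a)) g) = 1)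

include hec he1 hχc hχ1 in
/-- `(e · χ₁)⁻¹` is continuous into `ℂ` (unit-norm values: the inverse is the conjugate). -/
theorem continuous_coe_mul_inv : Continuous fun b => ((((e * χ₁)⁻¹ : _ →* ℂˣ) b : ℂˣ) : ℂ) := by
  have h : ∀ b, ((((e * χ₁)⁻¹ : _ →* ℂˣ) b : ℂˣ) : ℂ) = (starRingEnd ℂ) (((e b : ℂˣ) : ℂ) * ((χ₁ b : ℂˣ) : ℂ)) := fun b => by
    rw [MonoidHom.inv_apply, MonoidHom.mul_apply, Units.val_inv_eq_inv_val, Units.val_mul]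
    refine Complex.inv_eq_conj ?_
    rw [norm_mul, he1, hχ1, mul_one]
  simp_rw [h]
  exact Complex.continuous_conj.comp (hec.mul hχc)

include he1 hχ1 in
/-- `(e · χ₁)⁻¹` is unitary. -/
theorem norm_coe_mul_inv (b) : ‖((((e * χ₁)⁻¹ : _ →* ℂˣ) b : ℂˣ) : ℂ)‖ = 1 := by
  rw [MonoidHom.inv_apply, MonoidHom.mul_apply, Units.val_inv_eq_inv_val, norm_inv, Units.val_mul, norm_mul, he1, hχ1, mul_one, inv_one]

include herat hχrat in
/-- `(e · χ₁)⁻¹` kills the finite parts of the rational points. -/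
theorem mul_inv_finPart_eq_one (g) (hg : g ∈ CMRat (L : Type) (lineVec (L : Type) a)) :
    ((e * χ₁)⁻¹ : _ →* ℂˣ) (UnitaryGroup.finPart (↥(maximalRealSubfield L)) (L : Type) (IsCMField.complexConj L) 1
      (Matrix.diagonal (lineVec (L : Type) a)) g) = 1 := by
  rw [MonoidHom.inv_apply, MonoidHom.mul_apply, herat g hg, hχrat g hg, mul_one, inv_one]

include hto hec he1 herat hχc hχ1 hχrat in
/-- **THE (χ) JUNCTION, ASSEMBLED**: for two continuous unitary characters `e`, `χ₁` of `U(⟨a⟩)(𝔸_{L⁺,f})` trivial on (the finite parts of)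
`U(⟨a⟩)(L⁺)` there is an automorphic character `χ̃` of `[U(1)] = ker N(𝔸)⧸L¹`, TRIVIAL ON THE ARCHIMEDEAN TORUS, with
`D.chiFin χ̃ u = e (φ u) * χ₁ (φ u)` for every `u` — the `hχ` row of ★ `ThetaJunction.exists_holReal_of_transport` with `e := finCharZero(1,·)`
(★ `finRepZero_inr_finSBReindex`) and `χ₁` the character of the line transport.
[cite: Liu2021, Def. 4.11 (l. 2090); proof of Prop. 4.13 (l. 2145); App. D §D.1 Step 3 (l. 5219–5221)] -/
theorem exists_chiFin_eq_mul :
    ∃ χ : PontryaginDual (↥(Literature.NumberTheory.Automorphic.relNormOneIdeles (↥(maximalRealSubfield L)) (L : Type)) ⧸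
      Literature.NumberTheory.Automorphic.relNormOneRat (↥(maximalRealSubfield L)) (L : Type)),
      (∀ y, χ (QuotientGroup.mk (Literature.NumberTheory.Automorphic.relNormOneInfToIdeles (↥(maximalRealSubfield L)) (L : Type) y)) = 1) ∧
        ∀ u : D.Uf, D.chiFin χ u = e (φ u) * χ₁ (φ u) :=
by
  refine ⟨cmCentreFinCharQuot (L : Type) 1 (Matrix.diagonal (lineVec (L : Type) a)) (e * χ₁)⁻¹
      (continuous_coe_mul_inv a e χ₁ hec he1 hχc hχ1) (norm_coe_mul_inv a e χ₁ he1 hχ1) (mul_inv_finPart_eq_one a e χ₁ herat hχrat),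
    fun y => ?_, fun u => ?_⟩
  · exact cmCentreFinCharQuot_mk_relNormOneInfToIdeles (L : Type) 1 (Matrix.diagonal (lineVec (L : Type) a)) (e * χ₁)⁻¹
      (continuous_coe_mul_inv a e χ₁ hec he1 hχc hχ1) (norm_coe_mul_inv a e χ₁ he1 hχ1) (mul_inv_finPart_eq_one a e χ₁ herat hχrat) y
  · exact chiFin_cmCentreFinCharQuot_eq_mul D a ha0 φ hto (e * χ₁)⁻¹
      (continuous_coe_mul_inv a e χ₁ hec he1 hχc hχ1) (norm_coe_mul_inv a e χ₁ he1 hχ1) (mul_inv_finPart_eq_one a e χ₁ herat hχrat)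
      (fun v => e (φ v)) (fun v => χ₁ (φ v)) (fun v => by rw [MonoidHom.inv_apply, MonoidHom.mul_apply]) u

end Assembled

end Summit.HodgeConjecture.HodgeConjecture.Cruxes.H413.ThetaNonvanishing

end
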